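import Literature.AlgebraicGeometry.Frobenioids.FrobeniusTypePrime
import Literature.AlgebraicGeometry.Frobenioids.PreFrobenioidDataOfFunctor
import Literature.AlgebraicGeometry.Frobenioids.BaseCategoryTheoreticityDefs
import Literature.AlgebraicGeometry.Frobenioids.CategoryTheoreticityFacts
import HarnessLib

/-!
# Frobenioids I, Remark 3.1.1: an iso-subanchor of a Frobenioid is never isotropic — PROOF

Mochizuki, *The geometry of Frobenioids I: the general theory*, Kyushu J. Math. **62** (2008),
kurims text p. 57 [cite: MochizukiFrdI2008, Rem. 3.1.1 p.57]:

> "An iso-subanchor of the Frobenioid `C` is never isotropic. [In particular, if `C` is of isotropic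
> type, then `C` is of quasi-isotropic type.] Indeed, by Proposition 1.10, (iv), an anchor is never
> isotropic. Thus, by Definition 1.3, (vii), (b), a subanchor is never isotropic. Now if `B → A` is
> a mono-minimal categorical quotient of `B` by a group `G ⊆ Aut_C(B)` such that `B` is a subanchor
> and `A` is isotropic, then applying the isotropification functor of Proposition 1.9, (v), yields a
> factorization `B → B' → A`, where `B → B'` is an isotropic hull [hence a monomorphism — cf.
> Definition 1.3, (v), (a)], such that `G` acts compatibly on `B'`; thus, by the definition of the
> term 'mono-minimal' it follows that the arrow `B → B'` is an isomorphism, i.e., that `B` is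
> isotropic — a contradiction."

PROVED here, following the printed argument (the compatible action of `G` on the hull `B'` is
obtained directly from the universal property of the isotropic hull, Def. 1.2 (iv); the functor of
Prop. 1.9 (v) is not needed). Proof-only companion (abc-iut cell node `FrdI:Rmk3.1.1`):
`PreFrobenioid.not_isIsotropic_of_isIsoSubanchor` in the vocabulary of the Def. 1.1–1.3 files, and
`remark311_holds : Remark311 (PreFrobenioidData.ofFunctor Φ F)` — the statement AS TYPED in
`BaseCategoryTheoreticityDefs.lean` (seat abc-iut-L1-t3), for every Frobenioid `F`, and the closed named fact
`FrdI.Remark311` of `CategoryTheoreticityFacts.lean` (`FrdI.Remark311_holds`). Inputs: Def. 1.3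
(v)(a), (vii)(a), (vii)(b) (`Frobenioid.lean`) and Prop. 1.10 (iv) in the form
`not_isAnchor_of_isIsotropic` (`FrobeniusTypePrime.lean`, seat abc-iut-L1-t1). No new definitions.
-/

namespace Literature.AlgebraicGeometry.Frobenioids

open CategoryTheory

universe w v v' u u'

namespace PreFrobenioid

variable {D : Type u} [Category.{v} D] {Φ : Dᵒᵖ ⥤ CommMonCat.{w}}
  {C : Type u'} [Category.{v'} C] {F : C ⥤ ElemFrobenioid Φ}

/-- "By Definition 1.3, (vii), (b), a subanchor is never isotropic" [given Prop. 1.10 (iv): an anchor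
is never isotropic] (FrdI Rem. 3.1.1 p. 57). [cite: MochizukiFrdI2008, Rem. 3.1.1 p.57] -/
theorem not_isIsotropic_of_isSubanchor (hF : IsFrobenioid F) {B : C} (hB : IsSubanchor B) :
    ¬ IsIsotropic F B := by
  rintro hBiso
  obtain ⟨B', hB', ⟨g⟩⟩ := hB
  exact not_isAnchor_of_isIsotropic hF (hF.vii_b g hBiso) hB'

/-- The universal property of an isotropic hull `h : B → B₁` transports every automorphism `γ` of
`B` to a unique endomorphism `γ₁` of `B₁` with `h ∘ ... `: `γ ≫ h = h ≫ γ₁` ("`G` acts compatibly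
[relative to the arrow `B → B'`] on `B'`", FrdI Rem. 3.1.1 p. 57). [cite: MochizukiFrdI2008, Rem. 3.1.1 p.57] -/
theorem IsIsotropicHull.existsUnique_conj {B B₁ : C} {h : B ⟶ B₁} (hh : IsIsotropicHull F h)
    (γ : B ⟶ B) : ∃! γ₁ : B₁ ⟶ B₁, h ≫ γ₁ = γ ≫ h :=
  hh.2.2.2 (γ ≫ h) hh.2.2.1

/-- The action of `Aut_C(B)` on an isotropic hull `B → B₁` of `B`, as a homomorphism
`Aut_C(B) → Aut_C(B₁)` (FrdI Rem. 3.1.1 p. 57: "`G` acts compatibly on `B'`").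
[cite: MochizukiFrdI2008, Rem. 3.1.1 p.57] -/
theorem IsIsotropicHull.exists_autHom {B B₁ : C} {h : B ⟶ B₁} (hh : IsIsotropicHull F h) :
    ∃ ρ : Aut B →* Aut B₁, ∀ γ : Aut B, γ.hom ≫ h = h ≫ (ρ γ).hom := by
  choose L hL hLu using fun γ : B ⟶ B => IsIsotropicHull.existsUnique_conj hh γ
  simp only at hL hLu
  -- `L` is multiplicative and unital by uniqueness
  have hL1 : L (𝟙 B) = 𝟙 B₁ := (hLu (𝟙 B) (𝟙 B₁) (by simp)).symm
  have hLmul : ∀ γ γ' : B ⟶ B, L (γ ≫ γ') = L γ ≫ L γ' := fun γ γ' => by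
    refine (hLu (γ ≫ γ') (L γ ≫ L γ') ?_).symm
    rw [← Category.assoc, hL γ, Category.assoc, hL γ', Category.assoc]
  -- automorphisms go to automorphisms
  let ρ₀ : Aut B → Aut B₁ := fun γ =>
    { hom := L γ.hom
      inv := L γ.inv
      hom_inv_id := by rw [← hLmul, γ.hom_inv_id, hL1]
      inv_hom_id := by rw [← hLmul, γ.inv_hom_id, hL1] }
  refine ⟨{ toFun := ρ₀, map_one' := ?_, map_mul' := ?_ }, fun γ => (hL γ.hom).symm⟩
  · ext
    exact hL1
  · intro γ γ'
    ext
    show L (γ'.hom ≫ γ.hom) = L γ'.hom ≫ L γ.hom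
    exact hLmul _ _

/-- **Remark 3.1.1** [FrdI p. 57]: an iso-subanchor of a Frobenioid is never isotropic. PROVED as
printed: for a mono-minimal categorical quotient `f : B → A` of a subanchor `B` by `G ⊆ Aut_C(B)` with
`A` isotropic, `f` factors through the isotropic hull `h : B → B₁` (a monomorphism, Def. 1.3 (v)(a)),
`G` acts compatibly on `B₁` — faithfully, `h` being mono — so mono-minimality makes `h` an
isomorphism and `B` isotropic (Def. 1.3 (vii)(b) along `h⁻¹`), contradicting "a subanchor is never
isotropic". [cite: MochizukiFrdI2008, Rem. 3.1.1 p.57] -/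
theorem not_isIsotropic_of_isIsoSubanchor (hF : IsFrobenioid F) {A : C} (hA : IsIsoSubanchor A) :
    ¬ IsIsotropic F A := by
  intro hAiso
  obtain ⟨B, G, f, hBsub, hmm⟩ := hA
  -- the isotropic hull of `B`
  obtain ⟨B₁, h, hh⟩ := hF.vii_a B
  haveI : Mono h := hF.v_a h hh.2.1
  -- `f : B → A` factors through the hull, `A` being isotropic
  obtain ⟨f', hf', -⟩ := hh.2.2.2 f hAiso
  -- `G` acts compatibly on `B₁`
  obtain ⟨ρ, hρ⟩ := IsIsotropicHull.exists_autHom hh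
  have hρinj : Function.Injective ρ := by
    intro γ γ' e
    have := hρ γ
    rw [e, ← hρ γ'] at this
    ext
    exact (cancel_mono h).mp this
  have hiso : IsIso h :=
    hmm.2 h f' hf' inferInstance
      ⟨G.map ρ, G.equivMapOfInjective ρ hρinj, fun γ => by
        rw [Subgroup.coe_equivMapOfInjective_apply]
        exact hρ γ⟩
  -- hence `B` is isotropic: contradiction
  exact not_isIsotropic_of_isSubanchor hF hBsub (hF.vii_b (inv h) hh.2.2.1)

/-- "[In particular, if `C` is of isotropic type, then `C` is of quasi-isotropic type.]" — in the
vocabulary of the Def. 1.1–1.3 files: in a Frobenioid of isotropic type there are no iso-subanchors,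
so "non-isotropic ⟺ iso-subanchor" holds trivially (FrdI Rem. 3.1.1 p. 57; cf.
`PreFrobenioidData.IsOfIsotropicType.isOfQuasiIsotropicType` in `BaseCategoryTheoreticityDefs.lean`).
[cite: MochizukiFrdI2008, Rem. 3.1.1 p.57] -/
theorem not_isIsoSubanchor_of_isOfIsotropicType (hF : IsFrobenioid F) (h : IsOfIsotropicType F)
    (A : C) : ¬ IsIsoSubanchor A :=
  fun hA => not_isIsotropic_of_isIsoSubanchor hF hA (h A)

end PreFrobenioid

/-- **Remark 3.1.1** AS TYPED in `BaseCategoryTheoreticityDefs.lean` (`Remark311 S : ∀ A, IsIsoSubanchor A →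
¬ S.IsIsotropic A`), discharged for the operations `S = PreFrobenioidData.ofFunctor Φ F` of every Frobenioid
`F : C → F_Φ` (abc-iut node `FrdI:Rmk3.1.1`). [cite: MochizukiFrdI2008, Rem. 3.1.1 p.57] -/
theorem remark311_holds {D : Type u} [Category.{v} D] (Φ : Dᵒᵖ ⥤ CommMonCat.{w}) {C : Type u'}
    [Category.{v'} C] (F : C ⥤ ElemFrobenioid Φ) (hF : PreFrobenioid.IsFrobenioid F) :
    Remark311 (PreFrobenioidData.ofFunctor Φ F) := fun A hA hiso =>
  PreFrobenioid.not_isIsotropic_of_isIsoSubanchor hF hA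
    ((PreFrobenioidData.ofFunctor_isIsotropic F A).mp hiso)

/-- Hence, AS TYPED: a Frobenioid of isotropic type is of quasi-isotropic type (the bracketed clause of
Remark 3.1.1, via t3's `IsOfIsotropicType.isOfQuasiIsotropicType`). [cite: MochizukiFrdI2008, Rem. 3.1.1 p.57] -/
theorem isOfQuasiIsotropicType_of_isOfIsotropicType {D : Type u} [Category.{v} D]
    (Φ : Dᵒᵖ ⥤ CommMonCat.{w}) {C : Type u'} [Category.{v'} C] (F : C ⥤ ElemFrobenioid Φ)
    (hF : PreFrobenioid.IsFrobenioid F) (h : (PreFrobenioidData.ofFunctor Φ F).IsOfIsotropicType) :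
    (PreFrobenioidData.ofFunctor Φ F).IsOfQuasiIsotropicType :=
  h.isOfQuasiIsotropicType _ (remark311_holds Φ F hF)

/-- **[FrdI] Remark 3.1.1** as the CLOSED named fact of `CategoryTheoreticityFacts.lean` (seat abc-iut-L1-t3):
DISCHARGED — in every Frobenioid an iso-subanchor is never isotropic. [cite: MochizukiFrdI2008, Rem. 3.1.1 p.57] -/
theorem FrdI.Remark311_holds : FrdI.Remark311 := fun F hF => remark311_holds _ F hF

end Literature.AlgebraicGeometry.Frobenioids
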